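import Mathlib
import HarnessLib

/-!
# [OURS · L1 W4.5(b) · EL♮(3)] HSUB(ReachTC⁺) — THE ORDER-ONE CONE PACK: an element `f ∈ (c)` of a local ring with `f ∉ 𝔪²` is
# `Φ(c)` for a LINEAR form `Φ` with a unit coefficient (registered stub `stub_elnat_tcPlusPointResolution`; driver p526242, brick K7c)

Crux `EquisingularLiftNat` = stmt-ResolutionOfSingularities-20038 (child EL♮(3) = stmt-ResolutionOfSingularities-20148), route
EquisingularLift, line `sections`. Helper file `--supports stmt-ResolutionOfSingularities-20148 --as helper` by res-L1-w45b-stub-1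
(HSUB(ReachTC⁺) assembly, res-L1-w45b-lead-2 GO 2026-08-27T10:45:46Z). HONEST FRAMING: OURS (cell res-hironaka, slot W4.5(b)); NOT a
statement of any manuscript; AI-written, weaker than expert review. No `sorry`; standard axioms.

WHY. At a REGULAR point `y` of the running curve, the in-carrier section `s` through `p = jG y` lies on `D = V(𝓢) ∩ V(K)` and both
the carrier `𝓢 = (h)` and the cone hypersurface `K = (f)` pass through `p` with ORDER ONE along `s` (`h, f ∉ 𝔪_p²`, because `V(𝓢)`
and `D` are regular at `p`). res-L1-w45b-stub-1's F⁺5 `comap_strictTransformIdeal_eq_of_model` (p519966) then wants each of them as a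
«cone pack» `(Φ(c))` for a FORM `Φ` of degree `1` in a frame `c` of `(ker s)_p` with `Φ̄ ≠ 0` modulo `(c)` and `Φ ≢ 0 mod 𝔪_p`.
This file supplies exactly that, for any local ring:

* `exists_linearForm_eval_eq_of_mem_span` — `f ∈ (c₁, …, c_r)` ⇒ `f = Φ(c)` for `Φ = Σ aᵢ Tᵢ` homogeneous of degree `1`;
* **`exists_linearForm_isUnit_coeff`** — if moreover all `cᵢ ∈ 𝔪` and `f ∉ 𝔪²`, some coefficient `aᵢ` is a UNIT;
* `map_ne_zero_of_isUnit_coeff` — hence `Φ` stays non-zero under ANY ring map into a non-trivial ring applied to its coefficients: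
  in particular `Φ mod (c) ≠ 0` (F⁺5's `hΦ`) and `(j♯ Φ) mod (j♯ c) ≠ 0` (F⁺5's `hΦbar`), `exists_linearForm_conePack`.

References: folklore (Nakayama-free linear algebra in a local ring); res-L1-w45b-stub-1 …NatStrictTransformComap (p519966).
-/

set_option linter.dupNamespace false -- mandated namespace `Summit.<Summit>.<Problem>` of this single-conjunct summit

noncomputable section

open MvPolynomial IsLocalRing

namespace Summit.ResolutionOfSingularities.ResolutionOfSingularities.Cruxes.EquisingularLiftNat.Sections

variable {R : Type*} [CommRing R]

/-- `f ∈ (c₁, …, c_r)` is the value at `c` of a linear form `Σ aᵢ Tᵢ`. [folklore] -/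
theorem exists_linearForm_eval_eq_of_mem_span {r : ℕ} (c : Fin r → R) {f : R} (hf : f ∈ Ideal.span (Set.range c)) :
    ∃ a : Fin r → R, MvPolynomial.eval c (∑ i, C (a i) * X i) = f ∧ (∑ i, C (a i) * X i : MvPolynomial (Fin r) R).IsHomogeneous 1 ∧
      ∀ i, ((∑ i, C (a i) * X i : MvPolynomial (Fin r) R)).coeff (Finsupp.single i 1) = a i := by
  classical
  obtain ⟨a, ha⟩ := Ideal.mem_span_range_iff_exists_fun.mp hf
  refine ⟨a, ?_, ?_, fun i => ?_⟩
  · rw [map_sum]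
    simp only [map_mul, eval_C, eval_X]
    exact ha
  · refine IsHomogeneous.sum _ _ _ fun i _ => ?_
    exact (isHomogeneous_X R i).C_mul (a i)
  · rw [coeff_sum]
    simp only [coeff_C_mul, coeff_X, Finsupp.single_eq_single_iff, mul_ite, mul_one, mul_zero]
    rw [Finset.sum_eq_single i]
    · simp
    · intro j _ hji
      rw [if_neg]
      rintro (⟨h, -⟩ | ⟨-, h⟩)
      · exact hji h
      · exact one_ne_zero h
    · intro h; exact absurd (Finset.mem_univ i) h

/-- **The order-one cone pack.** In a local ring, if all `cᵢ ∈ 𝔪`, `f ∈ (c)` and `f ∉ 𝔪²`, then `f = Φ(c)` for a linear form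
`Φ = Σ aᵢ Tᵢ` with some `aᵢ` a UNIT (otherwise `f ∈ 𝔪·𝔪`). [folklore] -/
theorem exists_linearForm_isUnit_coeff [IsLocalRing R] {r : ℕ} (c : Fin r → R) (hc : ∀ i, c i ∈ maximalIdeal R) {f : R}
    (hf : f ∈ Ideal.span (Set.range c)) (hf2 : f ∉ (maximalIdeal R) ^ 2) :
    ∃ Φ : MvPolynomial (Fin r) R, Φ.IsHomogeneous 1 ∧ MvPolynomial.eval c Φ = f ∧ ∃ i, IsUnit (Φ.coeff (Finsupp.single i 1)) := by
  classical
  obtain ⟨a, ha, hhom, hcoeff⟩ := exists_linearForm_eval_eq_of_mem_span c hf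
  refine ⟨∑ i, C (a i) * X i, hhom, ha, ?_⟩
  by_contra hnone
  push Not at hnone
  apply hf2
  rw [← ha, map_sum, pow_two]
  refine Ideal.sum_mem _ fun i _ => ?_
  simp only [map_mul, eval_C, eval_X]
  have hai : a i ∈ maximalIdeal R := by
    have h := hnone i
    rw [hcoeff i] at h
    exact (mem_maximalIdeal _).mpr (mem_nonunits_iff.mpr h)
  exact Ideal.mul_mem_mul hai (hc i)

omit [CommRing R] in
/-- A polynomial with a unit coefficient stays NON-ZERO after mapping its coefficients into any non-trivial ring. [folklore] -/
theorem map_ne_zero_of_isUnit_coeff {R S : Type*} [CommRing R] [CommRing S] [Nontrivial S] (g : R →+* S) {σ : Type*}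
    {Φ : MvPolynomial σ R} {m : σ →₀ ℕ} (hu : IsUnit (Φ.coeff m)) : MvPolynomial.map g Φ ≠ 0 := by
  intro h
  have h1 : (MvPolynomial.map g Φ).coeff m = 0 := by rw [h, coeff_zero]
  rw [coeff_map] at h1
  exact (hu.map g).ne_zero h1

/-- **The order-one cone pack in F⁺5's currency.** `R` local, `c : Fin r → 𝔪_R` a frame, `f ∈ (c)` with `f ∉ 𝔪_R²`, and `g : R → S`
any ring map with `(g ∘ c)` generating a PROPER ideal of `S` (e.g. the reduction `j♯_x` to the downstairs stalk, `(j♯ c) = 𝔪_x`): there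
is a form `Φ` of degree `1` with `f = Φ(c)`, `Φ mod (c) ≠ 0` and `(g Φ) mod (g c) ≠ 0`. [folklore] [OURS · L1 W4.5b] toward
`stub_elnat_tcPlusPointResolution`; NOT a statement of the manuscript. -/
theorem exists_linearForm_conePack [IsLocalRing R] {r : ℕ} (c : Fin r → R) (hc : ∀ i, c i ∈ maximalIdeal R) {f : R}
    (hf : f ∈ Ideal.span (Set.range c)) (hf2 : f ∉ (maximalIdeal R) ^ 2) {S : Type*} [CommRing S] (g : R →+* S)
    (hg : Ideal.span (Set.range fun i => g (c i)) ≠ ⊤) :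
    ∃ Φ : MvPolynomial (Fin r) R, Φ.IsHomogeneous 1 ∧ MvPolynomial.eval c Φ = f ∧
      MvPolynomial.map (Ideal.Quotient.mk (Ideal.span (Set.range c))) Φ ≠ 0 ∧
      MvPolynomial.map (Ideal.Quotient.mk (Ideal.span (Set.range fun i => g (c i)))) (MvPolynomial.map g Φ) ≠ 0 := by
  obtain ⟨Φ, hΦ1, hΦf, i, hu⟩ := exists_linearForm_isUnit_coeff c hc hf hf2
  have hcne : Ideal.span (Set.range c) ≠ ⊤ := by
    intro h
    have h1 : Ideal.span (Set.range c) ≤ maximalIdeal R := Ideal.span_le.mpr (by rintro _ ⟨i, rfl⟩; exact hc i)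
    rw [h] at h1
    exact (maximalIdeal.isMaximal R).ne_top (top_le_iff.mp h1)
  haveI : Nontrivial (R ⧸ Ideal.span (Set.range c)) := Ideal.Quotient.nontrivial_iff.mpr hcne
  haveI : Nontrivial (S ⧸ Ideal.span (Set.range fun i => g (c i))) := Ideal.Quotient.nontrivial_iff.mpr hg
  refine ⟨Φ, hΦ1, hΦf, map_ne_zero_of_isUnit_coeff _ hu, ?_⟩
  rw [MvPolynomial.map_map]
  exact map_ne_zero_of_isUnit_coeff _ hu

end Summit.ResolutionOfSingularities.ResolutionOfSingularities.Cruxes.EquisingularLiftNat.Sections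

end
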